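import Summits.CriticalPhenomena.CardyFormulaZ2.Theorems.CardyFlipRussoVoronoiHubFromSmirnovStubIdentificationCovariance

/-!
# Reflection covariance of the homogeneous annealed Voronoi crossing probability

Second helper file of the stub `stub_identification` (S4) of the line
`moebius-exact-delaunay-dilation-ward` for the crux `VoronoiHubFromSmirnov`
(stmt-CriticalPhenomena-6433, route `CardyFlipRusso`); companion of
`CardyFlipRussoVoronoiHubFromSmirnovStubIdentificationCovariance.lean` (orientation-PRESERVING
similarities).  Here: the orientation-REVERSING similarities `h z = a · conj z + v`, `a ≠ 0`, which
the asymptotic conformal invariance `ConformalNull` (holomorphic maps only) does not move, but which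
the identification programme also consumes (reflection symmetry of the limiting curve family,
Schramm 2000 §1; Werner 2007 §3.2).  Since `h` is anti-holomorphic the image rectangle is the
topological image `R.image h hc hi` (`ConformalRectangle.image`, Beffara 2008 Def. 3), and

  `homCrossProb (R.image h hc hi) δ = homCrossProb R (δ / ‖a‖)`.

Proof: as in the companion file — the Euclidean motion `τ p = conj (u⁻¹ (p − v/δ))`, `u = a/‖a‖`,
of configuration space satisfies `τ (h w / δ) = w / (δ/‖a‖)`, so the crossing event of the image is
the `(τ × τ)`-preimage of the crossing event of `R` at mesh `δ/‖a‖`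
(`crossEvent_image_eq_preimage`, pure geometry), and `τ` preserves Lebesgue measure
(`Complex.conjLIE`), whence the two-colour Poisson law is `τ`-invariant on all sets
(`lawBW_real_preimage_prodMap`).

References: I. Benjamini, O. Schramm, Comm. Math. Phys. 197 (1998), §1; J. F. C. Kingman, *Poisson
Processes* (1993), §2.3.
-/

noncomputable section

namespace Summit.CriticalPhenomena.CardyFormulaZ2.Cruxes.VoronoiHubFromSmirnov.MoebiusExactDelaunayDilationWard

open scoped Topology ENNReal ComplexConjugate
open Filter Set MeasureTheory Metric
open Literature.Analysis.FunctionSpaces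
open Literature.Probability.RandomPlanarGeometry

/-- **The crossing event of a moved rectangle**, topological-image form (pure geometry): if
`h = σ` is a homeomorphism of the plane and `τ` a Euclidean isometry with `τ (σ w / δ) = w / δ'`,
then the crossing event of `R.image h hc hi` at mesh `δ` is the preimage under `c ↦ (τ c₁, τ c₂)`
of the crossing event of `R` at mesh `δ'` (the companion file's
`crossEvent_imageUnivalent_eq_preimage` is its holomorphic case, `imageUnivalent_eq_image`). -/
theorem crossEvent_image_eq_preimage (R : ConformalRectangle) (h : ℂ → ℂ)
    (hc : ContinuousOn h (closure R.carrier)) (hi : InjOn h (closure R.carrier))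
    (σ : ℂ ≃ₜ ℂ) (hσ : ∀ z, h z = σ z) (τ : ℂ ≃ᵢ ℂ) (δ δ' : ℝ)
    (hστ : ∀ w, τ (σ w / (δ : ℂ)) = w / (δ' : ℂ)) :
    crossEvent (R.image h hc hi) δ =
      (fun c => (c.1.mapHomeomorph τ.toHomeomorph, c.2.mapHomeomorph τ.toHomeomorph)) ⁻¹'
        crossEvent R δ' := by
  obtain rfl : h = σ := funext hσ
  ext c
  simp only [crossEvent, mem_setOf_eq, mem_preimage, MarkedDomain.arc_image,
    MarkedDomain.closure_carrier_image, PointConfig.coe_mapHomeomorph,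
    IsometryEquiv.coe_toHomeomorph, exists_mem_image]
  have hset : ⇑σ '' closure R.carrier ∩
      {z | infDist (z / (δ : ℂ)) (c.1 : Set ℂ) ≤ infDist (z / (δ : ℂ)) (c.2 : Set ℂ)} =
      ⇑σ '' (closure R.carrier ∩ {z | infDist (z / (δ' : ℂ)) (τ '' (c.1 : Set ℂ)) ≤
        infDist (z / (δ' : ℂ)) (τ '' (c.2 : Set ℂ))}) := by
    rw [← image_inter_preimage]
    congr 1
    ext w
    simp only [mem_inter_iff, mem_preimage, mem_setOf_eq, black_transport σ τ δ δ' hστ]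
  rw [hset]
  refine exists_congr fun x => and_congr_right fun _ => exists_congr fun y =>
    and_congr_right fun _ => ?_
  exact joinedIn_image_homeomorph_iff σ _ x y

/-- **Covariance of the homogeneous annealed crossing probability under orientation-reversing
similarities** (registered helper of stub S4): for `h z = a · conj z + v` with `a ≠ 0` — a
reflection composed with a similarity — the image rectangle `R.image h hc hi` at mesh `δ` has the
crossing probability of `R` at mesh `δ / ‖a‖`; `a = 1, v = 0` is reflection invariance. -/
theorem homCrossProb_image_conjAffine : ∀ (R : ConformalRectangle) (h : ℂ → ℂ) (a v : ℂ),
    a ≠ 0 → (∀ z, h z = a * (starRingEnd ℂ) z + v) →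
    ∀ (δ : ℝ) (hc : ContinuousOn h (closure R.carrier)) (hi : InjOn h (closure R.carrier)),
      homCrossProb (R.image h hc hi) δ = homCrossProb R (δ / ‖a‖) := by
  intro R h a v ha hh δ hc hi
  have hna : (‖a‖ : ℂ) ≠ 0 := Complex.ofReal_ne_zero.2 (norm_ne_zero_iff.2 ha)
  -- the anti-similarity as a homeomorphism of the plane
  set σ : ℂ ≃ₜ ℂ := Complex.conjLIE.toHomeomorph.trans
    ((Homeomorph.mulLeft₀ a ha).trans (Homeomorph.addRight v)) with hσdef
  have hσ : ∀ z, h z = σ z := fun z => by rw [hh z]; rfl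
  -- the Euclidean motion of configuration space
  obtain ⟨u, hu⟩ : ∃ u : Circle, (u : ℂ) = a / (‖a‖ : ℂ) :=
    ⟨⟨a / (‖a‖ : ℂ), by simp [Submonoid.unitSphere, ha]⟩, rfl⟩
  set τ : ℂ ≃ᵢ ℂ := ((IsometryEquiv.subRight (v / (δ : ℂ))).trans
    (rotation u⁻¹).toIsometryEquiv).trans Complex.conjLIE.toIsometryEquiv with hτdef
  have hτapply : ∀ p, τ p = conj ((a / (‖a‖ : ℂ))⁻¹ * (p - v / (δ : ℂ))) := fun p => by
    simp only [hτdef, IsometryEquiv.trans_apply, LinearIsometryEquiv.coe_toIsometryEquiv,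
      rotation_apply, IsometryEquiv.subRight_apply, Circle.coe_inv, hu, Complex.conjLIE_apply]
  have hστ : ∀ w, τ (σ w / (δ : ℂ)) = w / ((δ / ‖a‖ : ℝ) : ℂ) := by
    intro w
    rw [hτapply, ← hσ, hh, Complex.ofReal_div]
    have key : (a / (‖a‖ : ℂ))⁻¹ * ((a * conj w + v) / (δ : ℂ) - v / (δ : ℂ)) =
        conj (w / ((δ : ℂ) / (‖a‖ : ℂ))) := by
      rw [map_div₀, map_div₀, Complex.conj_ofReal, Complex.conj_ofReal]
      rcases eq_or_ne (δ : ℂ) 0 with hδ | hδ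
      · simp [hδ]
      · field_simp
        ring
    rw [key, Complex.conj_conj]
  have hτvol : MeasurePreserving τ.toHomeomorph (volume : Measure ℂ) volume := by
    have hfun : (⇑τ.toHomeomorph : ℂ → ℂ) =
        ⇑Complex.conjLIE ∘ (⇑(rotation u⁻¹) ∘ fun z => z - v / (δ : ℂ)) := by
      ext z
      simp [hτdef]
    rw [hfun]
    exact Complex.conjLIE.measurePreserving.comp
      ((rotation u⁻¹).measurePreserving.comp (measurePreserving_sub_right volume _))
  unfold homCrossProb
  rw [crossEvent_image_eq_preimage R h hc hi σ hσ τ δ (δ / ‖a‖) hστ,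
    lawBW_real_preimage_prodMap τ.toHomeomorph hτvol]

/-- **Reflection invariance** (registered helper of stub S4): the mirror image `conj R` of a
conformal rectangle (marked points `conj (R.pt i)`, same cyclic order of the data) has the same
homogeneous annealed crossing probability as `R` at every mesh. -/
theorem homCrossProb_image_conj : ∀ (R : ConformalRectangle) (δ : ℝ)
    (hc : ContinuousOn (starRingEnd ℂ) (closure R.carrier))
    (hi : InjOn (starRingEnd ℂ) (closure R.carrier)),
      homCrossProb (R.image (starRingEnd ℂ) hc hi) δ = homCrossProb R δ := by
  intro R δ hc hi
  have h := homCrossProb_image_conjAffine R (starRingEnd ℂ) 1 0 one_ne_zero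
    (fun z => by rw [one_mul, add_zero]) δ hc hi
  rwa [norm_one, div_one] at h

end Summit.CriticalPhenomena.CardyFormulaZ2.Cruxes.VoronoiHubFromSmirnov.MoebiusExactDelaunayDilationWard

end
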